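import Literature.MathematicalPhysics.QuantumFieldTheory.Balaban1983to89.B8Eq1117KLevel
import Literature.MathematicalPhysics.QuantumFieldTheory.Balaban1983to89.B8Eq1112Local
import Literature.MathematicalPhysics.QuantumFieldTheory.Balaban1983to89.B8Eq1112Quotient

/-!
# `Balaban1983to89.B8SectEInLambdaWitness` — [Balaban1985RegularSpaces] Sect. E pp. 95–97 / [Balaban1985Averaging] Prop. 10 p. 50:
# the two tower-local Sect.-E point estimates ((1.115)/(1.121) = (213)/(214) of [3], and the Lipschitz bound (1.122)–(1.125)) WITH THE
# INDUCTIVE GAUGE TRANSFORMATION `u₁` READ THROUGH A `Λ_j(U₀, α₃)`-WITNESS instead of «`u₁ = glev_j` on `Bʲ(y)`» — so that they hold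
# VERBATIM for the INVERSE `u₁⁻¹` (route (a″) of the Theorem-4 knit: the Sect.-E chain is run on the pair `(e^{−iλ}, u₁⁻¹)`)

statement-level skeleton of published theorems with citation tags; proofs where landed; nothing here is a claim about the Yang–Mills mass gap

T. Bałaban, *Spaces of regular gauge field configurations on a lattice and gauge fixing conditions*, Commun. Math. Phys. **99** (1985)
75–102 `[Balaban1985RegularSpaces]` ("B8"; printed page = PDF page + 74), pp. 89–90, 95–97; [3] = T. Bałaban, *Averaging operations for
lattice gauge theories*, Commun. Math. Phys. **98** (1985) 17–51 `[Balaban1985Averaging]`, Prop. 10 (203)–(214) p. 50, (166)–(167) p. 44.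
PDF held: `paper:balaban1985-cmp99-regular-spaces-gauge-fixing`.  STATUS: published, refereed.

CITATION HEADER (lean-in-tree rule).  Cell `pub-ymgap` (YM Track A, DAG node N05 = [B8], HUMAN RULING D-0062), seat `pub-ymgap-dag-n04-b`
gen 3 («Sect. E for the inverse pair from the original pair's regime», LOCATED-1 / INTENT-1, INBOX l.11520).  WHAT IS REPRODUCED = the two
Sect.-E point estimates the k-level contraction of (1.117) consumes (`B8Eq1117KLevel.norm_Cnl_le_tower` / `.lipschitz_Cnl_tower`,
dag-n05-b; `B8Eq1115Concrete.eq214_local_B8`, this seat g0; `B8Eq1122Local.lipschitz1122_local`, dag-n05-b) in the form PRINT'S PROOF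
ACTUALLY USES: the only property of `u₁` entering (213)/(214) and (1.122)–(1.125) is `u₁ ∈ Λ_k(U₀, α₃)` ([3] p. 50 «u₁ ∈ Λ_k(U₀, α₃)»;
r04 `B7Eq214General.eq214_general_of207` and r05 `B8Eq1122Concrete.lipschitz1122` take exactly `InLambda L U₀ u₁ k α₃ _`).  The landed
tower-local forms bake in «`u₁ = glev L _ U₀ (expCfg B) j 0` on `Bʲ(y)`» ((106) of [3]), deriving the `Λ`-membership inside from
`B7Eq167General.inLambda_glev_general`.  THE THEOREM-4 KNIT OF RECORD (route (a″), `pub-ymgap-dag-n05-a` ruling INBOX l.11309; this seat's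
`B8Restr129Inversion`) runs Sect. E on the INVERSE pair `(e^{−iλ}, u₁⁻¹)`, and `u₁⁻¹` is NOT the gauge fixing (106) of the datum's small
field; what it IS, is a member of `Λ_k(U₀, α₃)` with the SAME `α₃`, because `Λ_k(U₀, α₃)` is closed under inversion for unitary data
(lit-balaban p05 `B8Eq1112Quotient.inLambda_inv` — the tacit step of B8 (1.112) p. 95).  This file therefore re-types the two point estimates
with the hypothesis «`u₁` AGREES ON `Bʲ(y)` WITH A GLOBAL `ũ ∈ Λ_j(π^*U₀, α₃)`» (`π^*U₀` = the clamped extension `B7Prop1Local.clampCfg` of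
the background from the tower — the device of `eq214_local`), and supplies the witnesses: for `u₁ = glev_j` (recovering the landed forms), for
its INVERSE, and for `u₁⁻¹` when `u₁` is Theorem 4's inductive transformation ((1.19)/(1.29): `InAx` + `Restr129`, dag-n05-b's
`glev_on_towers_of_axial`).  Kind «kernel-checked proof», theorems only: no `def`, no `… : Prop` fact, no existing module modified.
REUSED BY NAME (nothing restated): `B7Eq214General.eq214_general_of207`, `B8Eq1122Concrete.lipschitz1122`, `B8Eq1115Concrete.{utilG_congr_tower,
lamAvgG_congr_tower}`, `B8Ineq172Concrete.glev_congr_tower`, `B7Eq167General.inLambda_glev_general`, `B8Eq1112Local.glev_clamp_unitary_inLambda`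
(this seat g0), `B8Eq1112Quotient.inLambda_inv` (p05), `B7Prop2Explicit.prop2_unitaryUnits`, `B8Eq1117KLevel.glev_on_towers_of_axial`.

## THE PRINTED TEXT

[3] p. 50: «**Proposition 10.** … for u₁ ∈ Λ_k(U₀, α₃), u′ satisfying (176), (177) … Q′_j(u₁, λ, y) = (Q′_jλ)(y) + C′_j(u₁, λ, y), (213)
|C′_j(u₁, λ, y)| = O((α₃α₄ + α₄²)Lʲη). (214)».  B8 p. 96–97: «by the inequality (214) we have |C′(λ − H′X)| < C′₂(α₃ + α₄)α₄ (1.121) …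
|C′(λ − H′X₁) − C′(λ − H′X₂)| ≦ C′₂2B′₀(α₃ + α₄)|X₁ − X₂| (1.125)».  B8 p. 95: «u′ = u₂u₁⁻¹ satisfies the regularity conditions … This
follows from Proposition 8 of [3]» (the inverse-closure of `Λ_k`, (1.112)).

## WHAT IS CERTIFIED HERE (kernel; axioms `propext` / `Classical.choice` / `Quot.sound`)

Tower notation `[tlo L y j, thi L y j] = Bʲ(y)` (`B8Ineq130`); `π^*U₀ := clampCfg (tlo L y j) (thi L y j) U₀`.  A `Λ`-WITNESS for `u₁` at
`(j, y)` with constant `α₃` is a global `ũ : ℤᵈ → 𝔸ˣ` with `InLambda L (π^*U₀) ũ j α₃ L^{−j}` and `u₁ = ũ` on the sites of `Bʲ(y)`.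
* §1 `eq214_tower_of_witness` — (213)/(214) = (1.115)/(1.121) at every level-`m` site of the tower for ANY `u₁` with a `Λ`-witness (from
  `eq214_general_of207` for the clamped data, transferred by locality); `norm_Cnl_le_tower_of_witness` — (1.121) at the point `(j, y)`:
  `‖C′_j(u₁, μ)(y)‖ ≤ C2p·(α₃ + α₄)·α₄`.
* §2 `lipschitz1122_tower_of_witness` — (1.122)/(1.125) on the tower for any `u₁` with a `Λ`-witness (from `lipschitz1122`);
  `lipschitz_Cnl_tower_of_witness` — at the point `(j, y)`: `‖C′_j(u₁, μ₁)(y) − C′_j(u₁, μ₂)(y)‖ ≤ C2p·2m·(α₃ + α₄)`.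
* §3 WITNESSES: `witness_of_glev` (`u₁ = glev_j` on `Bʲ(y)` ⇒ witness with `α₃ = 40d·c`, any averaging-closed `G`);
  `witness_unitary_of_glev` (C⋆, unitary data: a UNITARY-valued witness, this seat's `glev_clamp_unitary_inLambda`);
  **`witness_inv_of_unitary`** (C⋆: a unitary witness for `u₁` gives a witness for `u₁⁻¹` with the SAME `α₃` — `inLambda_inv`);
  **`witness_inv_of_glev`**; **`witness_inv_of_axial`** (`u₁` = Theorem 4's inductive transformation: `InAx` + `Restr129` ⇒ a witness for
  `u₁⁻¹` at every `(j, y ∈ Λ_j)`).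
Consumed by `B8SectEKLevelInLambda` (E1/E4 of dag-n05-b re-run in witness form; `D′` and (1.114) for the inverse pair).

## HONEST SCOPE — what is NOT claimed

(i) Constants/windows are the lineage's (`C2p = 16C′_gen`, `≤` for `<`, `ℤᵈ` carriers, `η`-free level scale `L^{−j}`); `α₃` is now a free
parameter (print's `α₃`), instantiated to `40d·c` by the glev witnesses.  (ii) The clamped background in the witness is a DEVICE (as in
`eq214_local`), not in print.  (iii) The inverse witnesses need unitary data (print: `G ⊂ U(N)`) and the plaquette regularity of the full
small field `e^{B}U₀` on the tower ((1.34)/(1.141)-type, for the unitarity of the gauge fixing's averages) — displayed.  (iv) Nothing of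
(1.117), `D′`, (1.114) here (next module).  Count-neutral; N05 NOT discharged; nothing continuum / ℝ⁴ / OS / mass-gap / Clay.
-/

noncomputable section

open NormedSpace Finset

namespace Literature.MathematicalPhysics.QuantumFieldTheory.Balaban1983to89.B8SectEInLambdaWitness

open B7Prop1Explicit B7Prop2Explicit B7Prop3Flat B7Prop1Local B7Eq167Flat B7Eq167General
open MatrixLog (mlog)
open B7Eq170Flat (cj cj_apply)
open B7Prop10General (C6 C4G utilG)
open B7Prop10Flat (one_le_C5 C4'_nonneg C5'_nonneg)
open B7Prop9Flat (C5')
open B7Eq214General (Cgen lamAvgG eq214_general_of207)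
open B8Ineq130 (tlo thi inBox_of_le tlo_zero thi_zero)
open B7Eq84Concrete (glev)
open B7Eq92Concrete (mgauge)
open B8Ineq172Concrete (glev_congr_tower)
open B8Eq1115Concrete (utilG_congr_tower lamAvgG_congr_tower)
open B7Eq78Linearization (zdBlocking QprimeIter)
open B8Eq119TwistedAxial (bgT InAx Restr129)
open B8Eq178Averages (Qnl Qnl_eq_mlog_utilG qprimeIter_bgT_eq_lamAvgG)
open B8Eq1123Concrete (Cnl)
open B8Ineq125Concrete (C2p C2p_nonneg)
open B8Eq1122Concrete (lipschitz1122)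
open B8Eq1112Local (glev_clamp_unitary_inLambda)
open B8Eq1112Quotient (inLambda_inv)
open B8Eq1117KLevel (glev_on_towers_of_axial)

-- `Site` alone could resolve to the torus sites of `Setup.lean`; re-export the `ℤ^d` sites of `B7Prop1Explicit`.
export B7Prop1Explicit (Site)

variable {d : ℕ}

/-! ## §0 Device: the clamped site function `μ ∘ π` and its global (207)-type bounds -/

section Clamp

variable {𝔸 : Type*} [NormedRing 𝔸] [NormedAlgebra ℂ 𝔸] [CompleteSpace 𝔸]
variable {L j : ℕ} {y : Site d} {V : Site d → Fin d → 𝔸ˣ} {μ : Site d → 𝔸} {a t : ℝ}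

omit [NormedAlgebra ℂ 𝔸] [CompleteSpace 𝔸] in
/-- The pair of STRICT (207)-type bounds for `μ ∘ π` on all of `ℤᵈ` (w.r.t. the clamped background `π^*V`) from the same on the tower
`Bʲ(y)` (device: on a degenerate bond the transport is `1` and the two values coincide). [folklore] -/
private theorem clamp_bounds_lt (hlohi : ∀ i, tlo L y j i ≤ thi L y j i) (ht : 0 < t)
    (hb : ∀ x : Site d, InBox (tlo L y j) (thi L y j) x → ‖μ x‖ < a)
    (ha : ∀ (x : Site d) (κ : Fin d), InBox (tlo L y j) (thi L y j) x → InBox (tlo L y j) (thi L y j) (x + e κ) →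
      ‖cj (V x κ) (μ (x + e κ)) - μ x‖ < t) :
    (∀ x : Site d, ‖μ (clamp (tlo L y j) (thi L y j) x)‖ < a) ∧
      ∀ (x : Site d) (κ : Fin d), ‖cj (clampCfg (tlo L y j) (thi L y j) V x κ) (μ (clamp (tlo L y j) (thi L y j) (x + e κ))) -
        μ (clamp (tlo L y j) (thi L y j) x)‖ < t := by
  refine ⟨fun x => hb _ (clamp_inBox hlohi x), fun x κ => ?_⟩
  by_cases hP : tlo L y j κ ≤ x κ ∧ x κ < thi L y j κ
  · have hx := clamp_inBox hlohi x
    have hxe : InBox (tlo L y j) (thi L y j) (clamp (tlo L y j) (thi L y j) x + e κ) := by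
      rw [← clamp_add_e_of hP]; exact clamp_inBox hlohi _
    simp only [clampCfg, hP, and_self, if_true, clamp_add_e_of hP]
    exact ha _ κ hx hxe
  · simp only [clampCfg, hP, if_false, clamp_add_e_of_not (hlohi κ) hP, cj_apply, Units.val_one, inv_one, one_mul, mul_one,
      sub_self, norm_zero]
    exact ht

omit [NormedAlgebra ℂ 𝔸] [CompleteSpace 𝔸] in
/-- The pair of NON-STRICT (207)-type bounds for `μ ∘ π` (the modulus `m ≥ 0` of a difference). [folklore] -/
private theorem clamp_bounds_le (hlohi : ∀ i, tlo L y j i ≤ thi L y j i) (ht : 0 ≤ t)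
    (hb : ∀ x : Site d, InBox (tlo L y j) (thi L y j) x → ‖μ x‖ ≤ a)
    (ha : ∀ (x : Site d) (κ : Fin d), InBox (tlo L y j) (thi L y j) x → InBox (tlo L y j) (thi L y j) (x + e κ) →
      ‖cj (V x κ) (μ (x + e κ)) - μ x‖ ≤ t) :
    (∀ x : Site d, ‖μ (clamp (tlo L y j) (thi L y j) x)‖ ≤ a) ∧
      ∀ (x : Site d) (κ : Fin d), ‖cj (clampCfg (tlo L y j) (thi L y j) V x κ) (μ (clamp (tlo L y j) (thi L y j) (x + e κ))) -
        μ (clamp (tlo L y j) (thi L y j) x)‖ ≤ t := by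
  refine ⟨fun x => hb _ (clamp_inBox hlohi x), fun x κ => ?_⟩
  by_cases hP : tlo L y j κ ≤ x κ ∧ x κ < thi L y j κ
  · have hx := clamp_inBox hlohi x
    have hxe : InBox (tlo L y j) (thi L y j) (clamp (tlo L y j) (thi L y j) x + e κ) := by
      rw [← clamp_add_e_of hP]; exact clamp_inBox hlohi _
    simp only [clampCfg, hP, and_self, if_true, clamp_add_e_of hP]
    exact ha _ κ hx hxe
  · simp only [clampCfg, hP, if_false, clamp_add_e_of_not (hlohi κ) hP, cj_apply, Units.val_one, inv_one, one_mul, mul_one,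
      sub_self, norm_zero]
    exact ht

end Clamp

/-! ## §1 (213)/(214) = (1.115)/(1.121) on the tower for any `u₁` with a `Λ`-witness -/

section Eq214

variable {𝔸 : Type*} [NormedRing 𝔸] [NormOneClass 𝔸] [NormedAlgebra ℂ 𝔸] [CompleteSpace 𝔸]
variable {L : ℕ} {G : Subgroup 𝔸ˣ} {j : ℕ} {y : Site d} {U₀ : Site d → Fin d → 𝔸ˣ} {α₀ α₃ α₄ : ℝ} {lam : Site d → 𝔸}
  {u₁ ut : Site d → 𝔸ˣ}

/-- **(213)–(214) OF [3] ON THE BLOCK TOWER FOR ANY `u₁` WITH A `Λ_j`-WITNESS** (B8 pp. 89–90 «the assumptions of Proposition 10 are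
satisfied and we have the representation (213) and the bounds (214) [3]»; used at (1.115)/(1.121) p. 96).  Setting: `L ≥ 2`, `G ⊂ U1`
averaging-closed, `U₀` `G`-valued and regular ON THE FINE BLOCK `Bʲ(y)` ONLY ((1.33) at level `j`); `u₁` EQUAL ON THE SITES OF `Bʲ(y)` TO A
GLOBAL `ũ ∈ Λ_j(π^*U₀, α₃)` ([3] (166)–(167) w.r.t. the clamped background, scale `L^{−j}`); `u′ = e^{λ}` with (1.77)/(207) on `Bʲ(y)` only
(`‖λ(x)‖ < α₄`, `‖R(U₀(b))λ(b₊) − λ(b₋)‖ < α₄L^{−j}`); the windows of `eq214_general_of207` in `α₃`.  THEN at every level-`m` site `z` of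
`Bⁿ(y)` (`n + m = j`): `‖Q′_m(u₁, λ)(z) − (Q′_mλ)(z)‖ ≤ 16C′_gen(α₃α₄ + α₄²)·Lᵐ·L^{−j}` — (213)'s remainder with the bound (214).  Proof: the
global theorem for `(π^*U₀, λ∘π, ũ)`, transferred by the locality of `ũ′ᵐ` and `Q′_m` on the tower.
[cite: Balaban1985RegularSpaces, (1.115) p.96, (1.121) p.96, p.89; Balaban1985Averaging, Proposition 10 (213)–(214) p.50, (166)–(167) p.44] -/
theorem eq214_tower_of_witness (hL : 2 ≤ L) (hG : AvgClosed d L G) (hU₀ : ∀ x κ, U₀ x κ ∈ G)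
    (hα : 0 < α₀) (hα3 : C0 d * α₀ ≤ 1 / 3) (hα2 : 2 * α₀ ≤ c2' d L)
    (h33 : pdevOn (tlo L y j) (thi L y j) U₀ < α₀ * (((L : ℝ) ^ j)⁻¹) ^ 2) (hL1 : 1 ≤ L)
    (hW : InLambda L (clampCfg (tlo L y j) (thi L y j) U₀) ut j α₃ (((L : ℝ) ^ j)⁻¹))
    (hu₁ : ∀ x : Site d, tlo L y j ≤ x → x ≤ thi L y j → u₁ x = ut x)
    (hα₄ : 0 < α₄) (h177b : ∀ x : Site d, InBox (tlo L y j) (thi L y j) x → ‖lam x‖ < α₄)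
    (h177a : ∀ (x : Site d) (κ : Fin d), InBox (tlo L y j) (thi L y j) x → InBox (tlo L y j) (thi L y j) (x + e κ) →
      ‖cj (U₀ x κ) (lam (x + e κ)) - lam x‖ < α₄ * ((L : ℝ) ^ j)⁻¹)
    (hα₃ : 0 ≤ α₃) (hα₃' : α₃ ≤ 1 / 200) (hs₁ : 200 * C6 d * α₄ ≤ 1) (hs₂ : 12000 * ((d : ℝ) + 1) * L * α₄ ≤ 1)
    (hs₃ : C4G d L * (α₀ + α₃ + 4 * α₄) ≤ 1)
    (hs₄ : 1024 * ((d : ℝ) + 1) * ((d : ℝ) + 4) * L ^ 2 * α₀ ≤ 1) (hs₅ : 32 * ((d : ℝ) + 1) ^ 2 * C6 d * L ^ 2 * α₀ ≤ 1)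
    (hs₆ : 16 * d * C5' d * C6 d * (L : ℝ) ^ 2 * α₀ ≤ 1) (hs₇ : 8 * d * C6 d * L * α₀ ≤ 1)
    {m n : ℕ} (hmn : n + m = j) (z : Site d) (hz : tlo L y n ≤ z) (hz' : z ≤ thi L y n) :
    ‖Qnl L U₀ (fun x => expUnit (lam x)) u₁ m z - QprimeIter (zdBlocking d L) (bgT L U₀) m lam z‖
      ≤ 16 * Cgen d * (α₃ * α₄ + α₄ ^ 2) * ((L : ℝ) ^ m * ((L : ℝ) ^ j)⁻¹) := by
  have hlohi : ∀ i, tlo L y j i ≤ thi L y j i := B8Ineq130.tlo_le_thi hL1 le_rfl j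
  have hUU : ∀ x κ, U₀ x κ ∈ U1 𝔸 := fun x κ => hG.le_U1 (hU₀ x κ)
  have hLj : (0 : ℝ) < (L : ℝ) ^ j := by positivity
  -- the extended data
  set U₀c := clampCfg (tlo L y j) (thi L y j) U₀ with hU₀c_def
  set lamc : Site d → 𝔸 := fun x => lam (clamp (tlo L y j) (thi L y j) x) with hlamc_def
  have hU₀c : ∀ x κ, U₀c x κ ∈ G := clampCfg_mem hU₀
  have h52c : pdev U₀c < α₀ * (((L : ℝ) ^ j)⁻¹) ^ 2 := (pdev_clampCfg_le hlohi hUU).trans_lt h33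
  have h₀ : AgreeOn (tlo L y j) (thi L y j) U₀ U₀c := (clampCfg_agree U₀).symm
  obtain ⟨h207b, h207a⟩ := clamp_bounds_lt (V := U₀) (μ := lam) hlohi (by positivity : 0 < α₄ * ((L : ℝ) ^ j)⁻¹) h177b h177a
  -- the GLOBAL (213)/(214) for the clamped data and the witness, `k ↦ j`
  have hglob := eq214_general_of207 hL hG hU₀c hα hα3 hα2 h52c h207a h207b hW hα₃ hα₃' hs₁ hs₂ hs₃ hs₄ hs₅ hs₆ hs₇ m
    (by omega) z
  -- transfer to the original data on the tower
  have hu' : ∀ x : Site d, tlo L y j ≤ x → x ≤ thi L y j → (fun x => expUnit (lam x)) x = (fun x => expUnit (lamc x)) x :=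
    fun x hx hx' => by simp only [hlamc_def, clamp_of_inBox (inBox_of_le hx hx')]
  have hlam : ∀ x : Site d, tlo L y j ≤ x → x ≤ thi L y j → lam x = lamc x :=
    fun x hx hx' => by simp only [hlamc_def, clamp_of_inBox (inBox_of_le hx hx')]
  rw [Qnl_eq_mlog_utilG, qprimeIter_bgT_eq_lamAvgG, utilG_congr_tower hL1 h₀ hu' hu₁ m n hmn z hz hz',
    lamAvgG_congr_tower hL1 h₀ hlam m n hmn z hz hz']
  exact hglob

/-- **(1.121) AT THE POINT `(j, y)` OF `𝔅_k` FOR ANY `u₁` WITH A `Λ_j`-WITNESS**: under the tower-local (1.33) on `Bʲ(y)`, (1.120) for `μ`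
at scale `L^{−j}`, and the `α₃`-windows, `‖C′_j(u₁, μ)(y)‖ ≤ C2p·(α₃ + α₄)·α₄` — the self-map bound the contraction of (1.117) consumes
(`B8Eq1117KLevel.norm_Cnl_le_tower` with «`u₁ = glev_j`» replaced by the witness).
[cite: Balaban1985RegularSpaces, (1.121) p.96; Balaban1985Averaging, (214) p.50] -/
theorem norm_Cnl_le_tower_of_witness (hL : 2 ≤ L) (hG : AvgClosed d L G) (hU₀ : ∀ x κ, U₀ x κ ∈ G)
    (hα : 0 < α₀) (hα3 : C0 d * α₀ ≤ 1 / 3) (hα4 : 4 * α₀ ≤ c2' d L)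
    (h33 : pdevOn (tlo L y j) (thi L y j) U₀ < α₀ * (((L : ℝ) ^ j)⁻¹) ^ 2) (hL1 : 1 ≤ L)
    (hW : InLambda L (clampCfg (tlo L y j) (thi L y j) U₀) ut j α₃ (((L : ℝ) ^ j)⁻¹))
    (hu₁ : ∀ x : Site d, tlo L y j ≤ x → x ≤ thi L y j → u₁ x = ut x)
    (hα₄ : 0 < α₄) {μ : Site d → 𝔸}
    (hμb : ∀ x : Site d, InBox (tlo L y j) (thi L y j) x → ‖μ x‖ < α₄)
    (hμa : ∀ (x : Site d) (κ : Fin d), InBox (tlo L y j) (thi L y j) x → InBox (tlo L y j) (thi L y j) (x + e κ) →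
      ‖cj (U₀ x κ) (μ (x + e κ)) - μ x‖ < α₄ * ((L : ℝ) ^ j)⁻¹)
    (hα₃ : 0 ≤ α₃) (hα₃' : α₃ ≤ 1 / 200) (hs₁ : 200 * C6 d * α₄ ≤ 1) (hs₂ : 12000 * ((d : ℝ) + 1) * L * α₄ ≤ 1)
    (hs₃ : C4G d L * (α₀ + α₃ + 4 * α₄) ≤ 1)
    (hs₄ : 1024 * ((d : ℝ) + 1) * ((d : ℝ) + 4) * L ^ 2 * α₀ ≤ 1) (hs₅ : 32 * ((d : ℝ) + 1) ^ 2 * C6 d * L ^ 2 * α₀ ≤ 1)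
    (hs₆ : 16 * d * C5' d * C6 d * (L : ℝ) ^ 2 * α₀ ≤ 1) (hs₇ : 8 * d * C6 d * L * α₀ ≤ 1) :
    ‖Cnl L U₀ u₁ j μ y‖ ≤ C2p d * (α₃ + α₄) * α₄ := by
  have hy : tlo L y 0 ≤ y := by rw [tlo_zero]
  have hy' : y ≤ thi L y 0 := by rw [thi_zero]
  have h := eq214_tower_of_witness hL hG hU₀ hα hα3 (by linarith) h33 hL1 hW hu₁ hα₄ hμb hμa hα₃ hα₃' hs₁ hs₂ hs₃ hs₄ hs₅ hs₆ hs₇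
    (m := j) (n := 0) (by omega) y hy hy'
  have hLj : (0 : ℝ) < (L : ℝ) ^ j := by positivity
  have e1 : (L : ℝ) ^ j * ((L : ℝ) ^ j)⁻¹ = 1 := mul_inv_cancel₀ hLj.ne'
  rw [e1, mul_one] at h
  rw [Cnl]
  refine h.trans_eq ?_
  simp only [C2p]
  ring

end Eq214

/-! ## §2 The Lipschitz bound (1.122)/(1.125) on the tower for any `u₁` with a `Λ`-witness -/

section Lip

variable {𝔸 : Type*} [NormedRing 𝔸] [NormOneClass 𝔸] [NormedAlgebra ℂ 𝔸] [CompleteSpace 𝔸]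
variable {L : ℕ} {G : Subgroup 𝔸ˣ} {j : ℕ} {y : Site d} {U₀ : Site d → Fin d → 𝔸ˣ} {α₀ α₃ α₄ : ℝ}
  {μ₁ μ₂ : Site d → 𝔸} {m : ℝ} {u₁ ut : Site d → 𝔸ˣ}

/-- **THE LIPSCHITZ BOUND OF (1.122)/(1.125) ON THE BLOCK TOWER FOR ANY `u₁` WITH A `Λ_j`-WITNESS** (B8 p. 97 «|C′(λ − H′X₁) − C′(λ − H′X₂)|
≦ C′₂2B′₀(α₃ + α₄)|X₁ − X₂|», region-dependent form).  Setting as `eq214_tower_of_witness`; `μ₁, μ₂` in the half-size set (1.119) on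
`Bʲ(y)` (`‖μᵢ(x)‖ < ½α₄`, `‖R(U₀(b))μᵢ(b₊) − μᵢ(b₋)‖ < ½α₄L^{−j}`) with `‖(μ₁ − μ₂)(x)‖ ≤ m`, `‖R(U₀(b))(μ₁ − μ₂)(b₊) − (μ₁ − μ₂)(b₋)‖ ≤ mL^{−j}` there
(`m ≥ 0`); the windows of `lipschitz1122` in `α₃`.  THEN at every level-`m′` site `z` of `Bⁿ(y)` (`n + m′ = j`):
`‖C′_{m′}(u₁, μ₁)(z) − C′_{m′}(u₁, μ₂)(z)‖ ≤ C2p·2m·(α₃ + α₄)·L^{m′}L^{−j}` (`B8Eq1122Local.lipschitz1122_local` with «`u₁ = glev_j`» replaced by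
the witness). [cite: Balaban1985RegularSpaces, (1.122)–(1.125) pp.96–97, (1.119) p.96; Balaban1985Averaging, Prop. 10 (213)–(214) p.50] -/
theorem lipschitz1122_tower_of_witness (hL : 2 ≤ L) (hG : AvgClosed d L G) (hU₀ : ∀ x κ, U₀ x κ ∈ G)
    (hα : 0 < α₀) (hα3 : C0 d * α₀ ≤ 1 / 3) (hα2 : 2 * α₀ ≤ c2' d L)
    (h33 : pdevOn (tlo L y j) (thi L y j) U₀ < α₀ * (((L : ℝ) ^ j)⁻¹) ^ 2) (hL1 : 1 ≤ L)
    (hW : InLambda L (clampCfg (tlo L y j) (thi L y j) U₀) ut j α₃ (((L : ℝ) ^ j)⁻¹))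
    (hu₁ : ∀ x : Site d, tlo L y j ≤ x → x ≤ thi L y j → u₁ x = ut x)
    (hα₄ : 0 < α₄) (hm : 0 ≤ m)
    (h₁b : ∀ x : Site d, InBox (tlo L y j) (thi L y j) x → ‖μ₁ x‖ < α₄ / 2)
    (h₁a : ∀ (x : Site d) (κ : Fin d), InBox (tlo L y j) (thi L y j) x → InBox (tlo L y j) (thi L y j) (x + e κ) →
      ‖cj (U₀ x κ) (μ₁ (x + e κ)) - μ₁ x‖ < α₄ / 2 * ((L : ℝ) ^ j)⁻¹)
    (h₂b : ∀ x : Site d, InBox (tlo L y j) (thi L y j) x → ‖μ₂ x‖ < α₄ / 2)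
    (h₂a : ∀ (x : Site d) (κ : Fin d), InBox (tlo L y j) (thi L y j) x → InBox (tlo L y j) (thi L y j) (x + e κ) →
      ‖cj (U₀ x κ) (μ₂ (x + e κ)) - μ₂ x‖ < α₄ / 2 * ((L : ℝ) ^ j)⁻¹)
    (hmb : ∀ x : Site d, InBox (tlo L y j) (thi L y j) x → ‖(μ₁ - μ₂) x‖ ≤ m)
    (hma : ∀ (x : Site d) (κ : Fin d), InBox (tlo L y j) (thi L y j) x → InBox (tlo L y j) (thi L y j) (x + e κ) →
      ‖cj (U₀ x κ) ((μ₁ - μ₂) (x + e κ)) - (μ₁ - μ₂) x‖ ≤ m * ((L : ℝ) ^ j)⁻¹)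
    (hα₃ : 0 ≤ α₃) (hα₃' : α₃ ≤ 1 / 200) (hs₁ : 200 * C6 d * α₄ ≤ 1) (hs₂ : 12000 * ((d : ℝ) + 1) * L * α₄ ≤ 1)
    (hs₃ : C4G d L * (α₀ + α₃ + 4 * α₄) ≤ 1)
    (hs₄ : 1024 * ((d : ℝ) + 1) * ((d : ℝ) + 4) * L ^ 2 * α₀ ≤ 1) (hs₅ : 32 * ((d : ℝ) + 1) ^ 2 * C6 d * L ^ 2 * α₀ ≤ 1)
    (hs₆ : 16 * d * C5' d * C6 d * (L : ℝ) ^ 2 * α₀ ≤ 1) (hs₇ : 8 * d * C6 d * L * α₀ ≤ 1)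
    {m' n : ℕ} (hmn : n + m' = j) (z : Site d) (hz : tlo L y n ≤ z) (hz' : z ≤ thi L y n) :
    ‖Cnl L U₀ u₁ m' μ₁ z - Cnl L U₀ u₁ m' μ₂ z‖ ≤ C2p d * (2 * m) * (α₃ + α₄) * ((L : ℝ) ^ m' * ((L : ℝ) ^ j)⁻¹) := by
  have hlohi : ∀ i, tlo L y j i ≤ thi L y j i := B8Ineq130.tlo_le_thi hL1 le_rfl j
  have hUU : ∀ x κ, U₀ x κ ∈ U1 𝔸 := fun x κ => hG.le_U1 (hU₀ x κ)
  have hLj : (0 : ℝ) < (L : ℝ) ^ j := by positivity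
  -- the extended data
  set U₀c := clampCfg (tlo L y j) (thi L y j) U₀ with hU₀c_def
  set μ₁c : Site d → 𝔸 := fun x => μ₁ (clamp (tlo L y j) (thi L y j) x) with hμ₁c_def
  set μ₂c : Site d → 𝔸 := fun x => μ₂ (clamp (tlo L y j) (thi L y j) x) with hμ₂c_def
  have hU₀c : ∀ x κ, U₀c x κ ∈ G := clampCfg_mem hU₀
  have h52c : pdev U₀c < α₀ * (((L : ℝ) ^ j)⁻¹) ^ 2 := (pdev_clampCfg_le hlohi hUU).trans_lt h33
  have h₀ : AgreeOn (tlo L y j) (thi L y j) U₀ U₀c := (clampCfg_agree U₀).symm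
  -- the global (1.119)-type hypotheses for the clamped site functions
  have hβ : 0 < α₄ / 2 * ((L : ℝ) ^ j)⁻¹ := by positivity
  obtain ⟨h₁bc, h₁ac⟩ := clamp_bounds_lt (V := U₀) (μ := μ₁) hlohi hβ h₁b h₁a
  obtain ⟨h₂bc, h₂ac⟩ := clamp_bounds_lt (V := U₀) (μ := μ₂) hlohi hβ h₂b h₂a
  have hdiff : (μ₁c - μ₂c) = fun x => (μ₁ - μ₂) (clamp (tlo L y j) (thi L y j) x) := by
    funext x; simp only [hμ₁c_def, hμ₂c_def, Pi.sub_apply]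
  obtain ⟨hmbc', hmac'⟩ := clamp_bounds_le (V := U₀) (μ := μ₁ - μ₂) hlohi (by positivity : 0 ≤ m * ((L : ℝ) ^ j)⁻¹) hmb hma
  have hmbc : ∀ x : Site d, ‖(μ₁c - μ₂c) x‖ ≤ m := fun x => by rw [hdiff]; exact hmbc' x
  have hmac : ∀ (x : Site d) (κ : Fin d), ‖cj (U₀c x κ) ((μ₁c - μ₂c) (x + e κ)) - (μ₁c - μ₂c) x‖ ≤ m * ((L : ℝ) ^ j)⁻¹ :=
    fun x κ => by rw [hdiff]; exact hmac' x κ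
  -- the GLOBAL Lipschitz bound for the clamped data and the witness, `k ↦ j`
  have hglob := lipschitz1122 hL hG hU₀c μ₁c μ₂c hα hα3 hα2 h52c h₁ac h₁bc h₂ac h₂bc hmac hmbc hW hα₃ hα₃' hs₁ hs₂ hs₃
    hs₄ hs₅ hs₆ hs₇ m' (by omega) z
  -- transfer to the original data on the tower
  have hC : ∀ {μ μc : Site d → 𝔸}, (∀ x : Site d, tlo L y j ≤ x → x ≤ thi L y j → μ x = μc x) →
      Cnl L U₀ u₁ m' μ z = Cnl L U₀c ut m' μc z := by
    intro μ μc hμ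
    have hu' : ∀ x : Site d, tlo L y j ≤ x → x ≤ thi L y j → (fun x => expUnit (μ x)) x = (fun x => expUnit (μc x)) x :=
      fun x hx hx' => by simp only [hμ x hx hx']
    simp only [Cnl, Qnl_eq_mlog_utilG]
    rw [qprimeIter_bgT_eq_lamAvgG L U₀ μ m', qprimeIter_bgT_eq_lamAvgG L U₀c μc m',
      utilG_congr_tower hL1 h₀ hu' hu₁ m' n hmn z hz hz', lamAvgG_congr_tower hL1 h₀ hμ m' n hmn z hz hz']
  have hμ₁ : ∀ x : Site d, tlo L y j ≤ x → x ≤ thi L y j → μ₁ x = μ₁c x :=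
    fun x hx hx' => by simp only [hμ₁c_def, clamp_of_inBox (inBox_of_le hx hx')]
  have hμ₂ : ∀ x : Site d, tlo L y j ≤ x → x ≤ thi L y j → μ₂ x = μ₂c x :=
    fun x hx hx' => by simp only [hμ₂c_def, clamp_of_inBox (inBox_of_le hx hx')]
  rw [hC hμ₁, hC hμ₂]
  exact hglob

/-- **THE LIPSCHITZ SENTENCE AT THE POINT `(j, y)` OF `𝔅_k` FOR ANY `u₁` WITH A `Λ_j`-WITNESS**: `‖C′_j(u₁, μ₁)(y) − C′_j(u₁, μ₂)(y)‖ ≤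
C2p·2m·(α₃ + α₄)` — the contraction input of (1.117) (`B8Eq1117KLevel.lipschitz_Cnl_tower` with «`u₁ = glev_j`» replaced by the witness).
[cite: Balaban1985RegularSpaces, (1.122)–(1.125) pp.96–97] -/
theorem lipschitz_Cnl_tower_of_witness (hL : 2 ≤ L) (hG : AvgClosed d L G) (hU₀ : ∀ x κ, U₀ x κ ∈ G)
    (hα : 0 < α₀) (hα3 : C0 d * α₀ ≤ 1 / 3) (hα4 : 4 * α₀ ≤ c2' d L)
    (h33 : pdevOn (tlo L y j) (thi L y j) U₀ < α₀ * (((L : ℝ) ^ j)⁻¹) ^ 2) (hL1 : 1 ≤ L)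
    (hW : InLambda L (clampCfg (tlo L y j) (thi L y j) U₀) ut j α₃ (((L : ℝ) ^ j)⁻¹))
    (hu₁ : ∀ x : Site d, tlo L y j ≤ x → x ≤ thi L y j → u₁ x = ut x)
    (hα₄ : 0 < α₄) (hm : 0 ≤ m)
    (h₁b : ∀ x : Site d, InBox (tlo L y j) (thi L y j) x → ‖μ₁ x‖ < α₄ / 2)
    (h₁a : ∀ (x : Site d) (κ : Fin d), InBox (tlo L y j) (thi L y j) x → InBox (tlo L y j) (thi L y j) (x + e κ) →
      ‖cj (U₀ x κ) (μ₁ (x + e κ)) - μ₁ x‖ < α₄ / 2 * ((L : ℝ) ^ j)⁻¹)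
    (h₂b : ∀ x : Site d, InBox (tlo L y j) (thi L y j) x → ‖μ₂ x‖ < α₄ / 2)
    (h₂a : ∀ (x : Site d) (κ : Fin d), InBox (tlo L y j) (thi L y j) x → InBox (tlo L y j) (thi L y j) (x + e κ) →
      ‖cj (U₀ x κ) (μ₂ (x + e κ)) - μ₂ x‖ < α₄ / 2 * ((L : ℝ) ^ j)⁻¹)
    (hmb : ∀ x : Site d, InBox (tlo L y j) (thi L y j) x → ‖(μ₁ - μ₂) x‖ ≤ m)
    (hma : ∀ (x : Site d) (κ : Fin d), InBox (tlo L y j) (thi L y j) x → InBox (tlo L y j) (thi L y j) (x + e κ) →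
      ‖cj (U₀ x κ) ((μ₁ - μ₂) (x + e κ)) - (μ₁ - μ₂) x‖ ≤ m * ((L : ℝ) ^ j)⁻¹)
    (hα₃ : 0 ≤ α₃) (hα₃' : α₃ ≤ 1 / 200) (hs₁ : 200 * C6 d * α₄ ≤ 1) (hs₂ : 12000 * ((d : ℝ) + 1) * L * α₄ ≤ 1)
    (hs₃ : C4G d L * (α₀ + α₃ + 4 * α₄) ≤ 1)
    (hs₄ : 1024 * ((d : ℝ) + 1) * ((d : ℝ) + 4) * L ^ 2 * α₀ ≤ 1) (hs₅ : 32 * ((d : ℝ) + 1) ^ 2 * C6 d * L ^ 2 * α₀ ≤ 1)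
    (hs₆ : 16 * d * C5' d * C6 d * (L : ℝ) ^ 2 * α₀ ≤ 1) (hs₇ : 8 * d * C6 d * L * α₀ ≤ 1) :
    ‖Cnl L U₀ u₁ j μ₁ y - Cnl L U₀ u₁ j μ₂ y‖ ≤ C2p d * (2 * m) * (α₃ + α₄) := by
  have hy : tlo L y 0 ≤ y := by rw [tlo_zero]
  have hy' : y ≤ thi L y 0 := by rw [thi_zero]
  have h := lipschitz1122_tower_of_witness hL hG hU₀ hα hα3 (by linarith) h33 hL1 hW hu₁ hα₄ hm h₁b h₁a h₂b h₂a hmb hma hα₃ hα₃'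
    hs₁ hs₂ hs₃ hs₄ hs₅ hs₆ hs₇ (m' := j) (n := 0) (by omega) y hy hy'
  have hLj : (0 : ℝ) < (L : ℝ) ^ j := by positivity
  have e1 : (L : ℝ) ^ j * ((L : ℝ) ^ j)⁻¹ = 1 := mul_inv_cancel₀ hLj.ne'
  rw [e1, mul_one] at h
  exact h

end Lip

/-! ## §3 Witnesses: the gauge fixing `glev_j`, its inverse, and Theorem 4's inductive `u₁` inverted -/

section WitnessGlev

variable {𝔸 : Type*} [NormedRing 𝔸] [NormOneClass 𝔸] [NormedAlgebra ℂ 𝔸] [CompleteSpace 𝔸]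
variable {L : ℕ} {G : Subgroup 𝔸ˣ} {j : ℕ} {y : Site d} {U₀ : Site d → Fin d → 𝔸ˣ} {α₀ c : ℝ} {B : Site d → Fin d → 𝔸}

omit [NormOneClass 𝔸] [NormedAlgebra ℂ 𝔸] [CompleteSpace 𝔸] in
/-- The zero extension of the exponent given on the bonds of the tower inherits (1.69) `|B_b| ≤ cL^{−j}` globally. [folklore] -/
private theorem norm_zeroExt_le (hc : 0 ≤ c * ((L : ℝ) ^ j)⁻¹)
    (h69 : ∀ (x : Site d) (κ : Fin d), InBox (tlo L y j) (thi L y j) x → InBox (tlo L y j) (thi L y j) (x + e κ) →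
      ‖B x κ‖ ≤ c * ((L : ℝ) ^ j)⁻¹) (x : Site d) (κ : Fin d) :
    ‖B7Prop3Flat.insCfg (B7Prop5Flat.bondsIn (tlo L y j) (thi L y j))
        (B7Prop5Flat.restr (B7Prop5Flat.bondsIn (tlo L y j) (thi L y j)) B) x κ‖ ≤ c * ((L : ℝ) ^ j)⁻¹ := by
  by_cases h : (x, κ) ∈ B7Prop5Flat.bondsIn (tlo L y j) (thi L y j)
  · rw [B7Prop5Flat.insCfg_restr_of_mem _ _ h]
    obtain ⟨hx, hx'⟩ := B7Prop5Flat.mem_bondsIn.mp h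
    exact h69 x κ hx hx'
  · simp only [B7Prop3Flat.insCfg, h, dite_false, norm_zero]
    exact hc

/-- **THE GAUGE FIXING `glev_j` HAS A `Λ_j`-WITNESS WITH `α₃ = 40d·c`** (the landed currency): under the tower-local (1.33) on `Bʲ(y)`,
(1.69) `|B_b| ≤ cL^{−j}` on the bonds of `Bʲ(y)` and `B7Eq167General`'s smallness at `k = j` (conditions on `α₀` and `c` alone), any `u₁`
with `u₁ = glev L _ U₀ e^{B} j 0` on `Bʲ(y)` agrees there with the GLOBAL gauge fixing of the extended data `(π^*U₀, e^{B^♭})` (`B^♭` = zero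
extension), which lies in `Λ_j(π^*U₀, 40d·c)` ([3] Props. 8–9 via `inLambda_glev_general`).  With this witness §1–§2 are EXACTLY the landed
`eq214_local_B8` / `lipschitz1122_local`. [cite: Balaban1985RegularSpaces, p.89 (after (1.76)), (1.69) p.88; Balaban1985Averaging, (166)–(167) p.44, (106) p.33] -/
theorem witness_of_glev (hL : 2 ≤ L) (hG : AvgClosed d L G) (hU₀ : ∀ x κ, U₀ x κ ∈ G)
    (hα : 0 < α₀) (hα3 : C0 d * α₀ ≤ 1 / 3) (hα4 : 4 * α₀ ≤ c2' d L)
    (h33 : pdevOn (tlo L y j) (thi L y j) U₀ < α₀ * (((L : ℝ) ^ j)⁻¹) ^ 2) (hc : 0 ≤ c)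
    (h69 : ∀ (x : Site d) (κ : Fin d), InBox (tlo L y j) (thi L y j) x → InBox (tlo L y j) (thi L y j) (x + e κ) →
      ‖B x κ‖ ≤ c * ((L : ℝ) ^ j)⁻¹)
    (hsmall : Real.exp (4 * (800 * ((d : ℝ) + 1) ^ 2 * ((d : ℝ) + 4)) * α₀) * (1 + 8 * (131072 * ((d : ℝ) + 1) ^ 2) * c) ≤ 2)
    (hc₃ : 2 * c ≤ c3 d L) (hs : 128 * (d : ℝ) * c ≤ 1) (hL1 : 1 ≤ L) {u₁ : Site d → 𝔸ˣ}
    (hu₁ : ∀ x : Site d, tlo L y j ≤ x → x ≤ thi L y j → u₁ x = glev L hL1 U₀ (expCfg B) j 0 x) :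
    ∃ ut : Site d → 𝔸ˣ, InLambda L (clampCfg (tlo L y j) (thi L y j) U₀) ut j (40 * d * c) (((L : ℝ) ^ j)⁻¹) ∧
      ∀ x : Site d, tlo L y j ≤ x → x ≤ thi L y j → u₁ x = ut x := by
  have hlohi : ∀ i, tlo L y j i ≤ thi L y j i := B8Ineq130.tlo_le_thi hL1 le_rfl j
  have hUU : ∀ x κ, U₀ x κ ∈ U1 𝔸 := fun x κ => hG.le_U1 (hU₀ x κ)
  have hLj : (0 : ℝ) < (L : ℝ) ^ j := by positivity
  set U₀c := clampCfg (tlo L y j) (thi L y j) U₀ with hU₀c_def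
  set Bc := B7Prop3Flat.insCfg (B7Prop5Flat.bondsIn (tlo L y j) (thi L y j))
    (B7Prop5Flat.restr (B7Prop5Flat.bondsIn (tlo L y j) (thi L y j)) B) with hBc_def
  have hU₀c : ∀ x κ, U₀c x κ ∈ G := clampCfg_mem hU₀
  have h52c : pdev U₀c < α₀ * (((L : ℝ) ^ j)⁻¹) ^ 2 := (pdev_clampCfg_le hlohi hUU).trans_lt h33
  have hb : 0 ≤ c * ((L : ℝ) ^ j)⁻¹ := by positivity
  have hkey : (L : ℝ) ^ j * (c * ((L : ℝ) ^ j)⁻¹) = c := by field_simp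
  have hBc : ∀ x κ, ‖Bc x κ‖ ≤ c * ((L : ℝ) ^ j)⁻¹ := norm_zeroExt_le hb h69
  have h₀ : AgreeOn (tlo L y j) (thi L y j) U₀ U₀c := (clampCfg_agree U₀).symm
  have h₁ : AgreeOn (tlo L y j) (thi L y j) (expCfg B) (expCfg Bc) :=
    B7Prop5Flat.agreeOn_expCfg (B7Prop5Flat.agreeOn_insCfg_restr _ _ B)
  have hΛ := inLambda_glev_general hL hG hU₀c hα hα3 hα4 h52c hb hBc (by rw [hkey]; exact hsmall) (by rw [hkey]; exact hc₃)
    (by rw [hkey]; exact hs) hL1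
  rw [hkey] at hΛ
  refine ⟨glev L hL1 U₀c (expCfg Bc) j 0, hΛ, fun x hx hx' => ?_⟩
  rw [hu₁ x hx hx']
  exact glev_congr_tower hL1 h₀ h₁ j 0 (by omega) x hx hx'

end WitnessGlev

section WitnessInv

variable {𝔸 : Type*} [CStarAlgebra 𝔸] [Nontrivial 𝔸]
variable {L : ℕ} {j : ℕ} {y : Site d} {U₀ : Site d → Fin d → 𝔸ˣ} {α₀ α₃ αP c : ℝ} {B : Site d → Fin d → 𝔸}

/-- **A UNITARY `Λ_j`-WITNESS FOR `u₁` GIVES A `Λ_j`-WITNESS FOR `u₁⁻¹` WITH THE SAME `α₃`** — the inverse-closure of `Λ_k(U₀, α₃)` for unitary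
data (B8 (1.112) p. 95 tacit step; p05 `B8Eq1112Quotient.inLambda_inv`: `\overline{R₀u⁻¹}ʲ = (\overline{R₀u}ʲ)⁻¹`, `|A⁻¹ − 1| = |A − 1|`,
`|AB⁻¹ − 1| = |A⁻¹B − 1|` for unitaries), at the clamped background `π^*U₀` (unitary-valued, with unitary averaged levels by Prop. 2 of [3]
under the tower-local (1.33)): the witness `ũ⁻¹`.  Windows: Prop. 2's (`C₀α₀ ≤ ⅓`, `2α₀ ≤ c₂′`) and `α₃ ≤ ¼`.
[cite: Balaban1985RegularSpaces, (1.112) p.95; Balaban1985Averaging, (166)–(167) p.44, Prop. 2 p.26] -/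
theorem witness_inv_of_unitary (hL : 2 ≤ L) (hU₀ : ∀ x κ, U₀ x κ ∈ unitaryUnits 𝔸)
    (hα : 0 < α₀) (hα3 : C0 d * α₀ ≤ 1 / 3) (hα2 : 2 * α₀ ≤ c2' d L)
    (h33 : pdevOn (tlo L y j) (thi L y j) U₀ < α₀ * (((L : ℝ) ^ j)⁻¹) ^ 2) (hL1 : 1 ≤ L)
    (hα₃ : 0 ≤ α₃) (hα₃' : α₃ ≤ 1 / 4) {u₁ ut : Site d → 𝔸ˣ}
    (hut : ∀ x, ut x ∈ unitaryUnits 𝔸)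
    (hW : InLambda L (clampCfg (tlo L y j) (thi L y j) U₀) ut j α₃ (((L : ℝ) ^ j)⁻¹))
    (hu₁ : ∀ x : Site d, tlo L y j ≤ x → x ≤ thi L y j → u₁ x = ut x) :
    ∃ ut' : Site d → 𝔸ˣ, InLambda L (clampCfg (tlo L y j) (thi L y j) U₀) ut' j α₃ (((L : ℝ) ^ j)⁻¹) ∧
      ∀ x : Site d, tlo L y j ≤ x → x ≤ thi L y j → u₁⁻¹ x = ut' x := by
  have hlohi : ∀ i, tlo L y j i ≤ thi L y j i := B8Ineq130.tlo_le_thi hL1 le_rfl j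
  have hUU : ∀ x κ, U₀ x κ ∈ U1 𝔸 := fun x κ => unitaryUnits_le_U1 (hU₀ x κ)
  have hLj : (0 : ℝ) < (L : ℝ) ^ j := by positivity
  set U₀c := clampCfg (tlo L y j) (thi L y j) U₀ with hU₀c_def
  have hU₀c : ∀ x κ, U₀c x κ ∈ unitaryUnits 𝔸 := clampCfg_mem hU₀
  have h52c : pdev U₀c < α₀ * (((L : ℝ) ^ j)⁻¹) ^ 2 := (pdev_clampCfg_le hlohi hUU).trans_lt h33
  -- the averaged levels of the clamped background are unitary (Prop. 2 of [3])
  have hV : ∀ i < j, ∀ (x : Site d) (κ : Fin d), avgIter L U₀c i x κ ∈ unitaryUnits 𝔸 := fun i hi x κ =>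
    (prop2_unitaryUnits L hL j U₀c hU₀c hα hα3 hα2 h52c).2 i hi.le x κ
  have hs : α₃ * (L : ℝ) ^ j * ((L : ℝ) ^ j)⁻¹ ≤ 1 / 4 := by
    rw [mul_assoc, mul_inv_cancel₀ hLj.ne', mul_one]; exact hα₃'
  refine ⟨ut⁻¹, inLambda_inv hV hut hW hL1 (by positivity) hα₃ hs, fun x hx hx' => ?_⟩
  rw [Pi.inv_apply, Pi.inv_apply, hu₁ x hx hx']

/-- **THE GAUGE FIXING `glev_j` HAS A UNITARY `Λ_j`-WITNESS** (unitary data): under the tower-local (1.33) on `Bʲ(y)`, (1.69) on the bonds of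
`Bʲ(y)` with `e^{B}` unitary-valued, the plaquette regularity of the full small field `e^{B}U₀` on `Bʲ(y)` ((1.34)/(1.141)-type, `αP`) and the
windows of this seat's `B8Eq1112Local.glev_clamp_unitary_inLambda`, any `u₁` with `u₁ = glev L _ U₀ e^{B} j 0` on `Bʲ(y)` agrees there with the
global gauge fixing of the CLAMPED data `(π^*U₀, π^*e^{B})`, unitary-valued and in `Λ_j(π^*U₀, 40d·c)`.
[cite: Balaban1985RegularSpaces, p.89, (1.69) p.88, (1.112) p.95; Balaban1985Averaging, (106) p.33, (166)–(167) p.44] -/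
theorem witness_unitary_of_glev (hd : 1 ≤ d) (hL : 2 ≤ L) (hU₀ : ∀ x κ, U₀ x κ ∈ unitaryUnits 𝔸)
    (hα : 0 < α₀) (hα3 : C0 d * α₀ ≤ 1 / 3) (hα4 : 4 * α₀ ≤ c2' d L)
    (h33 : pdevOn (tlo L y j) (thi L y j) U₀ < α₀ * (((L : ℝ) ^ j)⁻¹) ^ 2) (hc : 0 ≤ c)
    (hsmall : Real.exp (4 * (800 * ((d : ℝ) + 1) ^ 2 * ((d : ℝ) + 4)) * α₀) * (1 + 8 * (131072 * ((d : ℝ) + 1) ^ 2) * c) ≤ 2)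
    (hc₃ : 2 * c ≤ c3 d L) (hsm : 2048 * (d : ℝ) * c ≤ 1)
    (hαP : 0 < αP) (hαP3 : C0 d * αP ≤ 1 / 3) (hαP2 : 2 * αP ≤ c2' d L) (hL1 : 1 ≤ L)
    (hBu : ∀ (x : Site d) (κ : Fin d), expCfg B x κ ∈ unitaryUnits 𝔸)
    (h69 : ∀ (x : Site d) (κ : Fin d), InBox (tlo L y j) (thi L y j) x → InBox (tlo L y j) (thi L y j) (x + e κ) →
      ‖B x κ‖ ≤ c * ((L : ℝ) ^ j)⁻¹)
    (hP : pdevOn (tlo L y j) (thi L y j) (expCfg B * U₀) < αP * (((L : ℝ) ^ j)⁻¹) ^ 2) {u₁ : Site d → 𝔸ˣ}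
    (hu₁ : ∀ x : Site d, tlo L y j ≤ x → x ≤ thi L y j → u₁ x = glev L hL1 U₀ (expCfg B) j 0 x) :
    ∃ ut : Site d → 𝔸ˣ, (∀ x, ut x ∈ unitaryUnits 𝔸) ∧
      InLambda L (clampCfg (tlo L y j) (thi L y j) U₀) ut j (40 * d * c) (((L : ℝ) ^ j)⁻¹) ∧
      ∀ x : Site d, tlo L y j ≤ x → x ≤ thi L y j → u₁ x = ut x := by
  obtain ⟨hun, hΛ⟩ := glev_clamp_unitary_inLambda (y := y) (j := j) (B := B) hd hL hU₀ hα hα3 hα4 h33 hc hsmall hc₃ hsm hαP hαP3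
    hαP2 hL1 hBu h69 hP
  have h₀ : AgreeOn (tlo L y j) (thi L y j) U₀ (clampCfg (tlo L y j) (thi L y j) U₀) := (clampCfg_agree U₀).symm
  have h₁ : AgreeOn (tlo L y j) (thi L y j) (expCfg B) (clampCfg (tlo L y j) (thi L y j) (expCfg B)) :=
    (clampCfg_agree (expCfg B)).symm
  refine ⟨_, hun, hΛ, fun x hx hx' => ?_⟩
  rw [hu₁ x hx hx']
  exact glev_congr_tower hL1 h₀ h₁ j 0 (by omega) x hx hx'

/-- **`(glev_j)⁻¹` HAS A `Λ_j`-WITNESS WITH THE SAME `α₃ = 40d·c`** — `witness_unitary_of_glev` + `witness_inv_of_unitary`: for `u₁ = glev_j`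
on `Bʲ(y)` (unitary data, windows as there and `40d·c ≤ ¼`), the INVERSE `u₁⁻¹` agrees on `Bʲ(y)` with a global member of
`Λ_j(π^*U₀, 40d·c)`.  This is the `u₁`-input of the Sect.-E point estimates §1–§2 for the INVERSE PAIR `(e^{−iλ}, u₁⁻¹)` of the Theorem-4 knit
(route (a″)). [cite: Balaban1985RegularSpaces, (1.112) p.95, p.97; Balaban1985Averaging, Prop. 10 p.50, (166)–(167) p.44] -/
theorem witness_inv_of_glev (hd : 1 ≤ d) (hL : 2 ≤ L) (hU₀ : ∀ x κ, U₀ x κ ∈ unitaryUnits 𝔸)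
    (hα : 0 < α₀) (hα3 : C0 d * α₀ ≤ 1 / 3) (hα4 : 4 * α₀ ≤ c2' d L)
    (h33 : pdevOn (tlo L y j) (thi L y j) U₀ < α₀ * (((L : ℝ) ^ j)⁻¹) ^ 2) (hc : 0 ≤ c)
    (hsmall : Real.exp (4 * (800 * ((d : ℝ) + 1) ^ 2 * ((d : ℝ) + 4)) * α₀) * (1 + 8 * (131072 * ((d : ℝ) + 1) ^ 2) * c) ≤ 2)
    (hc₃ : 2 * c ≤ c3 d L) (hsm : 2048 * (d : ℝ) * c ≤ 1)
    (hαP : 0 < αP) (hαP3 : C0 d * αP ≤ 1 / 3) (hαP2 : 2 * αP ≤ c2' d L) (hL1 : 1 ≤ L)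
    (hBu : ∀ (x : Site d) (κ : Fin d), expCfg B x κ ∈ unitaryUnits 𝔸)
    (h69 : ∀ (x : Site d) (κ : Fin d), InBox (tlo L y j) (thi L y j) x → InBox (tlo L y j) (thi L y j) (x + e κ) →
      ‖B x κ‖ ≤ c * ((L : ℝ) ^ j)⁻¹)
    (hP : pdevOn (tlo L y j) (thi L y j) (expCfg B * U₀) < αP * (((L : ℝ) ^ j)⁻¹) ^ 2) {u₁ : Site d → 𝔸ˣ}
    (hu₁ : ∀ x : Site d, tlo L y j ≤ x → x ≤ thi L y j → u₁ x = glev L hL1 U₀ (expCfg B) j 0 x) :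
    ∃ ut' : Site d → 𝔸ˣ, InLambda L (clampCfg (tlo L y j) (thi L y j) U₀) ut' j (40 * d * c) (((L : ℝ) ^ j)⁻¹) ∧
      ∀ x : Site d, tlo L y j ≤ x → x ≤ thi L y j → u₁⁻¹ x = ut' x := by
  obtain ⟨ut, hun, hΛ, hag⟩ := witness_unitary_of_glev hd hL hU₀ hα hα3 hα4 h33 hc hsmall hc₃ hsm hαP hαP3 hαP2 hL1 hBu h69 hP hu₁
  have h40 : 40 * (d : ℝ) * c ≤ 1 / 4 := by
    have hd' : (0 : ℝ) ≤ d := by positivity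
    nlinarith [hsm, hc, hd']
  exact witness_inv_of_unitary hL hU₀ hα hα3 (by linarith) h33 hL1 (by positivity) h40 hun hΛ hag

/-- **THEOREM 4'S INDUCTIVE `u₁`, INVERTED, HAS A `Λ_j`-WITNESS AT EVERY POINT OF `𝔅_k`** — for `u₁` with `U₁^{u₁}U₀ ∈ Ax_k(𝔅_k, U₀)`
((1.19)/(1.34), `InAx`, `U₁ = e^{B}`) and (1.29) (`Restr129`), «`u₁` is given by (106)» on every tower (dag-n05-b's `glev_on_towers_of_axial`
from this seat's `B8Eq106Local`), hence by `witness_inv_of_glev`: for all `j ≤ k`, `y ∈ Λ_j`, the inverse `u₁⁻¹` agrees on `Bʲ(y)` with a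
global member of `Λ_j(π^*U₀, 40d·c)` — under the tower-local (1.33), (1.69), unitarity and full-field regularity at each `(j, y)`.  THE
ORIGINAL PAIR'S REGIME ONLY: no hypothesis is stated at `u₁⁻¹`.
[cite: Balaban1985RegularSpaces, p.88 (after (1.69)), (1.19) p.79, (1.29) p.81, (1.112) p.95, p.97; Balaban1985Averaging, (106) p.33] -/
theorem witness_inv_of_axial (hd : 1 ≤ d) (hL : 2 ≤ L) (hU₀ : ∀ x κ, U₀ x κ ∈ unitaryUnits 𝔸) {k : ℕ} (Λ : ℕ → Set (Site d))
    (hα : 0 < α₀) (hα3 : C0 d * α₀ ≤ 1 / 3) (hα4 : 4 * α₀ ≤ c2' d L) (hc : 0 ≤ c)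
    (hsmall : Real.exp (4 * (800 * ((d : ℝ) + 1) ^ 2 * ((d : ℝ) + 4)) * α₀) * (1 + 8 * (131072 * ((d : ℝ) + 1) ^ 2) * c) ≤ 2)
    (hc₃ : 2 * c ≤ c3 d L) (hsm : 2048 * (d : ℝ) * c ≤ 1)
    (hαP : 0 < αP) (hαP3 : C0 d * αP ≤ 1 / 3) (hαP2 : 2 * αP ≤ c2' d L) (hL1 : 1 ≤ L)
    (hBu : ∀ (x : Site d) (κ : Fin d), expCfg B x κ ∈ unitaryUnits 𝔸)
    (h33 : ∀ j, j ≤ k → ∀ y ∈ Λ j, pdevOn (tlo L y j) (thi L y j) U₀ < α₀ * (((L : ℝ) ^ j)⁻¹) ^ 2)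
    (h69 : ∀ j, j ≤ k → ∀ y ∈ Λ j, ∀ (x : Site d) (κ : Fin d), InBox (tlo L y j) (thi L y j) x →
      InBox (tlo L y j) (thi L y j) (x + e κ) → ‖B x κ‖ ≤ c * ((L : ℝ) ^ j)⁻¹)
    (hP : ∀ j, j ≤ k → ∀ y ∈ Λ j, pdevOn (tlo L y j) (thi L y j) (expCfg B * U₀) < αP * (((L : ℝ) ^ j)⁻¹) ^ 2)
    {u₁ : Site d → 𝔸ˣ} (hAx : InAx L k Λ U₀ (mgauge U₀ u₁ (expCfg B) * U₀)) (h129 : Restr129 L k Λ U₀ u₁) :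
    ∀ j, j ≤ k → ∀ y ∈ Λ j, ∃ ut' : Site d → 𝔸ˣ,
      InLambda L (clampCfg (tlo L y j) (thi L y j) U₀) ut' j (40 * d * c) (((L : ℝ) ^ j)⁻¹) ∧
      ∀ x : Site d, tlo L y j ≤ x → x ≤ thi L y j → u₁⁻¹ x = ut' x := fun j hj y hy =>
  witness_inv_of_glev hd hL hU₀ hα hα3 hα4 (h33 j hj y hy) hc hsmall hc₃ hsm hαP hαP3 hαP2 hL1 hBu (h69 j hj y hy) (hP j hj y hy)
    (glev_on_towers_of_axial hL1 Λ hAx h129 j hj y hy)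

/-- **THEOREM 4'S INDUCTIVE `u₁` ITSELF HAS A `Λ_j`-WITNESS AT EVERY POINT OF `𝔅_k`** (`α₃ = 40d·c`, any averaging-closed `G`): the landed
currency, for consumers who want both orders from one module. [cite: Balaban1985RegularSpaces, p.88, (1.19) p.79, (1.29) p.81; Balaban1985Averaging, (106) p.33, (166)–(167) p.44] -/
theorem witness_of_axial {𝔹 : Type*} [NormedRing 𝔹] [NormOneClass 𝔹] [NormedAlgebra ℂ 𝔹] [CompleteSpace 𝔹]
    (hL : 2 ≤ L) {G : Subgroup 𝔹ˣ} (hG : AvgClosed d L G) {U₀ : Site d → Fin d → 𝔹ˣ} (hU₀ : ∀ x κ, U₀ x κ ∈ G) {k : ℕ}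
    (Λ : ℕ → Set (Site d)) {B : Site d → Fin d → 𝔹}
    (hα : 0 < α₀) (hα3 : C0 d * α₀ ≤ 1 / 3) (hα4 : 4 * α₀ ≤ c2' d L) (hc : 0 ≤ c)
    (hsmall : Real.exp (4 * (800 * ((d : ℝ) + 1) ^ 2 * ((d : ℝ) + 4)) * α₀) * (1 + 8 * (131072 * ((d : ℝ) + 1) ^ 2) * c) ≤ 2)
    (hc₃ : 2 * c ≤ c3 d L) (hs : 128 * (d : ℝ) * c ≤ 1) (hL1 : 1 ≤ L)
    (h33 : ∀ j, j ≤ k → ∀ y ∈ Λ j, pdevOn (tlo L y j) (thi L y j) U₀ < α₀ * (((L : ℝ) ^ j)⁻¹) ^ 2)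
    (h69 : ∀ j, j ≤ k → ∀ y ∈ Λ j, ∀ (x : Site d) (κ : Fin d), InBox (tlo L y j) (thi L y j) x →
      InBox (tlo L y j) (thi L y j) (x + e κ) → ‖B x κ‖ ≤ c * ((L : ℝ) ^ j)⁻¹)
    {u₁ : Site d → 𝔹ˣ} (hAx : InAx L k Λ U₀ (mgauge U₀ u₁ (expCfg B) * U₀)) (h129 : Restr129 L k Λ U₀ u₁) :
    ∀ j, j ≤ k → ∀ y ∈ Λ j, ∃ ut : Site d → 𝔹ˣ,
      InLambda L (clampCfg (tlo L y j) (thi L y j) U₀) ut j (40 * d * c) (((L : ℝ) ^ j)⁻¹) ∧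
      ∀ x : Site d, tlo L y j ≤ x → x ≤ thi L y j → u₁ x = ut x := fun j hj y hy =>
  witness_of_glev hL hG hU₀ hα hα3 hα4 (h33 j hj y hy) hc (h69 j hj y hy) hsmall hc₃ hs hL1
    (glev_on_towers_of_axial hL1 Λ hAx h129 j hj y hy)

end WitnessInv

#print axioms eq214_tower_of_witness
#print axioms norm_Cnl_le_tower_of_witness
#print axioms lipschitz1122_tower_of_witness
#print axioms lipschitz_Cnl_tower_of_witness
#print axioms witness_of_glev
#print axioms witness_inv_of_unitary
#print axioms witness_unitary_of_glev
#print axioms witness_inv_of_glev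
#print axioms witness_inv_of_axial
#print axioms witness_of_axial

end Literature.MathematicalPhysics.QuantumFieldTheory.Balaban1983to89.B8SectEInLambdaWitness

end
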